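import Summits.BirchSwinnertonDyer.BirchSwinnertonDyer.Theorems.PrintCf2SplitBadTwoRestrictedSelmerRelaxedSummandExponent
import Summits.BirchSwinnertonDyer.BirchSwinnertonDyer.Theorems.PrintCf2SplitBadTwoRestrictedSelmerEigenProjector
import Summits.BirchSwinnertonDyer.BirchSwinnertonDyer.Theorems.PrintCf2SplitBadTwoRestrictedSelmerConjTransportFrame
import Summits.BirchSwinnertonDyer.BirchSwinnertonDyer.Theorems.PrintCf2SplitBadTwoInertiaFixedTorsionSharp
import Summits.BirchSwinnertonDyer.BirchSwinnertonDyer.Theorems.PrintCf2SplitBadTwoAdditiveAtSeven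
import HarnessLib

/-!
# Crux `PrintCf2.SplitBadTwoRankOneOfFacts` (stmt-BirchSwinnertonDyer-20368), road α v10.3 — the RELAXED CONJUGATE FINITENESS
# `hfinR′` of the (R-TOP) assembly, from `hfinB′` and (via the conjugation transport) from `hfinB`

Cell `bsd-print-cf2`, width seat `bsd-line-cf2-p1-w2` g10 (prover-bsd-line-cf2-p1-w2-g10-0); `--supports
stmt-BirchSwinnertonDyer-20368` (helper, Theses-free). HONEST FRAMING: nothing here closes a crux or a stub; BSD is not
proved by any of this; no summit statement is proved by this seat. THEOREMS ONLY (no definition, no named fact, no `sorry`).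

WHAT. The hypothesis **`hfinR′`** of -w4 g9's `RestrictedSelmerPair.natCard_endCoinvariants_eq_one_of_frame_of_conjFiniteness` (p673077,
marked FREE 22:15:49Z): for EVERY additive `e′ : E[2^∞] → W*′ = E[𝔮_{1−r}^∞]` underlying an intertwining endomorphism `j′` of `E[2^∞]`
(`j′ x = e′ x`) and every finite `R` away from `2`, the image `H¹(j′)(H¹_{𝓛^{ac,R}_v}(K, E[2^∞]))` is finite. PROOF (`finite_map_selmerGroup_of_apply_eq`,
generic `p`, any strict place `𝔮`): `j′` intertwining makes `e′` equivariant, so `j′ = ι′ ∘ e′` as intertwining maps (-w3 g9's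
`exists_summandProj` / `exists_summandIncl`) and `H¹(j′) = H¹(ι′) ∘ H¹(e′)` on classes; `H¹(e′)` carries the relaxed Selmer group into
`H¹_{𝓛^{ac,R}_𝔮}(K, W*′)` (`map_mem_selmerGroup_acStructure`), which is FINITE by -w3 g9's `finite_selmerGroup_acStructure_summand` from
`hfinB′ = Finite 𝔖_𝔮(K, W*′)` and a genuine equivariant projector (local finiteness of `H¹(K_w, W*′)`, `w ∤ p`) — on the frame -w7's
`exists_eigenProjector_two`. Frame forms: `hfinR'_of_finite_conj` (⟸ hfinB′) and **`hfinR'_of_frame` (⟸ hfinB, through -w2 g10's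
conjugation transport `ConjTransport.finite_restrictedSelmerBase_conj_of_finite`)**. With `ConjTransport.conjTransport_holds` (hTr),
`CMPrimes.exists_two_pow_nsmul_eq_zero_of_fixed_of_frame` (hfix) and this file, the (R-TOP) assembly's displayed inputs reduce to
`hfinB` (the frame's datum) and the three named facts `hPT`, `hPTs`, `hcd`.

References: R. Greenberg, LNM 1716 (1999) §3 Lemma 3.3 [GreenbergLNM1716]; D. Jetchev, C. Skinner, X. Wan, Camb. J. Math. 5 (2017)
Prop. 3.3.2 [JetchevSkinnerWan2017]; F. Castella, Camb. J. Math. 6 (2018) Def. 2.2 [Castella2018].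
-/

noncomputable section

open scoped Classical ContRepresentation

set_option linter.dupNamespace false
set_option autoImplicit false

namespace Summit.BirchSwinnertonDyer.BirchSwinnertonDyer.Theorems.PrintCf2.ConjTransport

open CategoryTheory NumberField IsDedekindDomain Field WeierstrassCurve
open Literature.NumberTheory.EllipticCurves Literature.NumberTheory.EllipticCurves.GreenbergSelmer
open Literature.NumberTheory.EllipticCurves.Agboola2007 Literature.NumberTheory.GaloisRepresentations
open Summit.BirchSwinnertonDyer.Rank1Residual.X11b Summit.BirchSwinnertonDyer.Rank1Residual.X11b.AcSelmer
open Summit.BirchSwinnertonDyer.Rank1Residual.X11b.LocBridge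
open Summit.BirchSwinnertonDyer.BirchSwinnertonDyer.Theorems.PrintCf2.RestrictedSelmerPair
open Summit.BirchSwinnertonDyer.BirchSwinnertonDyer.Theorems.PrintCf2.RelaxedExponent
open Summit.BirchSwinnertonDyer.BirchSwinnertonDyer.Theorems.PrintCf2.AdditiveAtSeven

universe u

/-! ## §1 Generic: the image of the relaxed Selmer group under `H¹(ι′ ∘ e′)` is finite -/

section Generic

variable {K : Type u} [Field K] [NumberField K] (V : WeierstrassCurve K) [V.IsElliptic] (p : ℕ) [Fact p.Prime]
  (π : V.endRing) (r' : ℤ_[p]) (𝔮 : HeightOneSpectrum (𝓞 K))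

/-- **The image `H¹(j′)(H¹_{𝓛^{ac,R}_𝔮}(K, E[p^∞]))` is finite** for every intertwining endomorphism `j′` of `E[p^∞]` whose values are
those of an additive `e′ : E[p^∞] → W*′` (`j′ x = e′ x`), every finite `R` away from `p`, granted `Finite 𝔖_𝔮(K, W*′)` and ONE equivariant
projector `e₀ : E[p^∞] → W*′` (`e₀|_{W*′} = id`, used only for the local finiteness of `H¹(K_w, W*′)`): `H¹(j′) = H¹(ι′) ∘ H¹(e′)` and
`H¹(e′)(H¹_{𝓛^{ac,R}_𝔮}(K, E[p^∞])) ⊆ H¹_{𝓛^{ac,R}_𝔮}(K, W*′)`, finite. [cite: GreenbergLNM1716, §3 Lemma 3.3]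
[cite: JetchevSkinnerWan2017, Prop. 3.3.2 (arXiv:1512.06894 p. 11)] -/
theorem finite_map_selmerGroup_of_apply_eq (e₀ : V.geomPrimaryTorsion p →+ ↥(V.endEigenPrimaryTorsion p π r'))
    (he₀₁ : ∀ x : ↥(V.endEigenPrimaryTorsion p π r'), e₀ x = x)
    (he₀ : ∀ (σ : absoluteGaloisGroup K) (x : V.geomPrimaryTorsion p), e₀ (σ • x) = σ • e₀ x)
    (hfin : Finite (restrictedSelmerBase ↥(V.endEigenPrimaryTorsion p π r') p 𝔮))
    (e' : V.geomPrimaryTorsion p →+ ↥(V.endEigenPrimaryTorsion p π r'))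
    (j' : (primaryGaloisModule V p).toContRepresentation →ⁱL (primaryGaloisModule V p).toContRepresentation)
    (hj' : ∀ x, j' x = (e' x : V.geomPrimaryTorsion p))
    {R : Set (HeightOneSpectrum (𝓞 K))} (hR : R.Finite) :
    Finite ↥(((acStructure (primaryGaloisModule V p) p 𝔮 R).selmerGroup).map (galoisCohomology.map j' 1)) := by
  -- the relaxed Selmer group of the summand is finite
  haveI hS := finite_selmerGroup_acStructure_summand V p π r' 𝔮 e₀ he₀₁ he₀ hR hfin
  -- `e′` is equivariant because `j′` is intertwining
  have he' : ∀ (σ : absoluteGaloisGroup K) (x : V.geomPrimaryTorsion p), e' (σ • x) = σ • e' x := fun σ x ↦ by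
    apply Subtype.ext
    have h := ContIntertwiningMap.isIntertwining j' σ x
    rw [hj', hj'] at h
    exact h
  obtain ⟨eI, heI⟩ := exists_summandProj V p π r' e' he'
  obtain ⟨ιI, hι⟩ := exists_summandIncl V p π r'
  -- `H¹(j′) = H¹(ι′) ∘ H¹(e′)` on classes
  have hfac : ∀ x : galoisCohomology (primaryGaloisModule V p) 1,
      galoisCohomology.map j' 1 x = galoisCohomology.map ιI 1 (galoisCohomology.map eI 1 x) := fun x ↦ by
    obtain ⟨φ, rfl⟩ := oneCocycleClass_surjective _ x
    rw [galoisCohomology.map_one_oneCocycleClass, galoisCohomology.map_one_oneCocycleClass,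
      galoisCohomology.map_one_oneCocycleClass]
    exact congrArg (oneCocycleClass _) (Subtype.ext (ContinuousMap.ext fun σ ↦ by
      change j' (φ.1 σ) = ιI (eI (φ.1 σ))
      rw [hj', heI, hι]))
  -- the image under `H¹(e′)` of the relaxed Selmer group lies in the relaxed Selmer group of the summand, whose image under
  -- `H¹(ι′)` is finite
  set S' := (acStructure (ofSMul ↥(V.endEigenPrimaryTorsion p π r') (isOpen_setOf_smul_eq_summand V p π r')) p 𝔮 R).selmerGroup
    with hS'
  haveI : Finite ↥(S'.map (galoisCohomology.map ιI 1)) :=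
    Finite.of_surjective (fun s : ↥S' ↦ (⟨galoisCohomology.map ιI 1 s, AddSubgroup.mem_map_of_mem _ s.2⟩ : ↥(S'.map _)))
      (by rintro ⟨_, s, hs, rfl⟩; exact ⟨⟨s, hs⟩, rfl⟩)
  have hle : ((acStructure (primaryGaloisModule V p) p 𝔮 R).selmerGroup).map (galoisCohomology.map j' 1) ≤
      S'.map (galoisCohomology.map ιI 1) := by
    rintro _ ⟨x, hx, rfl⟩
    exact ⟨galoisCohomology.map eI 1 x, map_mem_selmerGroup_acStructure eI p 𝔮 R hx, (hfac x).symm⟩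
  exact Finite.of_injective _ (AddSubgroup.inclusion_injective hle)

end Generic

/-! ## §2 The frame: `hfinR′` from `hfinB′`, and from `hfinB` through the conjugation transport -/

section Frame

variable (W : WeierstrassCurve ℚ) [W.IsElliptic] (K : Type) [Field K] [NumberField K]

/-- **`hfinR′ ⟸ hfinB′` on every S3c frame** (`j = −3375` from `C • W = cm7^{(d)}`; the projector from -w7's `exists_eigenProjector_two`
at the conjugate root `1 − r`): the hypothesis `hfinR′` of `natCard_endCoinvariants_eq_one_of_frame_of_conjFiniteness` VERBATIM.
[cite: GreenbergLNM1716, §3 Lemma 3.3] [cite: JetchevSkinnerWan2017, Prop. 3.3.2 (arXiv:1512.06894 p. 11)] -/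
theorem hfinR'_of_finite_conj {d : ℤ} (hd0 : d ≠ 0) (C : VariableChange ℚ) (hC : C • W = cm7.quadraticTwist (d : ℚ))
    (v : HeightOneSpectrum (𝓞 K)) (π : (W.baseChange K).endRing)
    (hrel : (π : AddMonoid.End (W.baseChange K).geomPoints) * π = π - 2) {r : ℤ_[2]} (hr : r * r = r - 2)
    (hfin' : Finite (restrictedSelmerBase ↥((W.baseChange K).endEigenPrimaryTorsion 2 π (1 - r)) 2 v)) :
    ∀ (e' : (W.baseChange K).geomPrimaryTorsion 2 →+ ↥((W.baseChange K).endEigenPrimaryTorsion 2 π (1 - r)))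
      (j' : (primaryGaloisModule (W.baseChange K) 2).toContRepresentation →ⁱL
        (primaryGaloisModule (W.baseChange K) 2).toContRepresentation),
      (∀ x, j' x = (e' x : (W.baseChange K).geomPrimaryTorsion 2)) →
      ∀ R : Set (HeightOneSpectrum (𝓞 K)), R.Finite → (∀ w ∈ R, ((2 : ℕ) : 𝓞 K) ∉ w.asIdeal) →
        Finite (((acStructure (primaryGaloisModule (W.baseChange K) 2) 2 v R).selmerGroup).map (galoisCohomology.map j' 1)) := by
  haveI : Fact (Nat.Prime 2) := ⟨Nat.prime_two⟩
  haveI : (W.baseChange K).IsElliptic := by rw [baseChange]; infer_instance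
  intro e' j' hj' R hR _
  have hj : W.j = -3375 := j_eq_of_smul_eq_cm7Twist hd0 W C hC
  obtain ⟨θ, hθ⟩ := exists_sq_eq_neg_seven_of_cmEndo_mem_endRing W K hj π hrel
  have hr' : (1 - r) * (1 - r) = (1 - r) - 2 := by linear_combination hr
  obtain ⟨e₀, he₀₁, -, -, he₀⟩ := exists_eigenProjector_two W hj K hθ π hrel hr'
  exact finite_map_selmerGroup_of_apply_eq (W.baseChange K) 2 π (1 - r) v e₀ he₀₁ he₀ hfin' e' j' hj' hR

/-- **`hfinR′ ⟸ hfinB` on every S3c frame** — the relaxed conjugate finiteness from the finiteness of the frame's OWN bottom group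
`𝔖_{v̄}(K, W*)` (its datum), through the conjugation transport `ConjTransport.finite_restrictedSelmerBase_conj_of_finite` (-w2 g10 file 3).
[cite: GreenbergLNM1716, §3 Lemma 3.3] [cite: Agboola2007, §6 (restricted Selmer groups over K)] -/
theorem hfinR'_of_frame {d : ℤ} (hd0 : d ≠ 0) (C : VariableChange ℚ) (hC : C • W = cm7.quadraticTwist (d : ℚ))
    (hK : IsImaginaryQuadratic K) (v vbar : HeightOneSpectrum (𝓞 K))
    (hv : ((2 : ℕ) : 𝓞 K) ∈ v.asIdeal) (hvbar : ((2 : ℕ) : 𝓞 K) ∈ vbar.asIdeal) (hne : vbar ≠ v)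
    (π : (W.baseChange K).endRing) (hrel : (π : AddMonoid.End (W.baseChange K).geomPoints) * π = π - 2)
    {r : ℤ_[2]} (hr : r * r = r - 2)
    (hfinB : Finite (restrictedSelmerBase ↥((W.baseChange K).endEigenPrimaryTorsion 2 π r) 2 vbar)) :
    ∀ (e' : (W.baseChange K).geomPrimaryTorsion 2 →+ ↥((W.baseChange K).endEigenPrimaryTorsion 2 π (1 - r)))
      (j' : (primaryGaloisModule (W.baseChange K) 2).toContRepresentation →ⁱL
        (primaryGaloisModule (W.baseChange K) 2).toContRepresentation),
      (∀ x, j' x = (e' x : (W.baseChange K).geomPrimaryTorsion 2)) →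
      ∀ R : Set (HeightOneSpectrum (𝓞 K)), R.Finite → (∀ w ∈ R, ((2 : ℕ) : 𝓞 K) ∉ w.asIdeal) →
        Finite (((acStructure (primaryGaloisModule (W.baseChange K) 2) 2 v R).selmerGroup).map (galoisCohomology.map j' 1)) :=
  hfinR'_of_finite_conj W K hd0 C hC v π hrel hr
    (finite_restrictedSelmerBase_conj_of_finite W K hK v vbar hv hvbar hne π hrel r hfinB)

end Frame

end Summit.BirchSwinnertonDyer.BirchSwinnertonDyer.Theorems.PrintCf2.ConjTransport

end
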